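import Literature.NumberTheory.EllipticCurves.CasselsTatePairingFunctorial
import Literature.NumberTheory.EllipticCurves.ShaPrimaryIsogenyProofs
import Literature.NumberTheory.EllipticCurves.IsogenyDualProofs
import Literature.NumberTheory.EllipticCurves.ShaTorsion
import HarnessLib

/-!
# The Cassels–Tate pairing on `Ш(E/K)[2^∞]` is `𝒪`-BALANCED for every `ℤ[ζ₃]`-action induced by an
# endo-isogeny: `⟨w a, b⟩ = ⟨a, w² b⟩ = ⟨a, −b − w b⟩` (alternating, antisymmetric, non-degenerate)

Topic `NumberTheory/EllipticCurves`, family `bsd`. Vocabulary: `Sha.lean` (the tree's `Ш(E/K)` on Mathlib continuous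
cohomology), `ShaIsogeny(Proofs).lean` (`Ш(f) = shaMap`, `H¹(f) = galH1Map`), `ShaPrimaryIsogenyProofs.lean`
(`Isogeny.shaMap_shaMap_eq_nsmul`: `Ш(ψ) Ш(φ) = deg φ`), `IsogenyDualProofs.lean` (`Isogeny.exists_dual_of_isElliptic`),
`ShaTorsion.lean` (`isTorsion_sha`), `BSDSha.lean` (`AddSubgroup.divisibleElements`), and THE NAMED FACT
`casselsTate_pairing_functorial K` (`CasselsTatePairingFunctorial.lean`: a family `B_W : Ш(W/K) × Ш(W/K) → ℚ/ℤ`,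
alternating, left kernel = divisible subgroup, ADJOINT along every dual pair `ψ ∘ φ = [deg φ]`; Milne *ADT* I
Prop. 6.9, Rem. 6.10(a), Thm. 6.13(a)).  THEOREMS ONLY (no definition / named fact / instance / notation / `sorry`;
D-0026, net debt 0 — the fact is DISPLAYED as the hypothesis `hCT`).  Seat `bsd-cm-k-ty1` (tenth seating), planner
GO D560 (2) / D561 (2) on OFFER #24 (WRAP-CT); helper of crux `stmt-BirchSwinnertonDyer-19804` (`UpperOffV0HSYPlus`),
rows k-p2 (TAIL = THEOREM K3/K3*).  No summit statement is proved or advanced by this file alone; nothing about the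
ORDER of `Ш` is asserted; BSD is not claimed.

## WHY (the consumer; planner D560 W-a/W-c)

The coupled Kolyvagin argument over `K = ℚ(ω)` at the inert prime `2` (cell memo two §57–§65, after McCallum
[McCallumLMS1991] §5) runs on `Ш(A_K/K)[2^∞] ⊕ Ш(B_K/K)[2^∞]` with the `𝒪 = ℤ[ω]`-SESQUILINEAR refinement of the
Cassels–Tate pairing (memo §59.1 (i), §64.0, (P5)/(P6)).  Its tree algebra,
`Summits/…/Theorems/SylvesterTwoHeegnerIndexUnramifiedQuadraticPairings.lean` §C/§D, consumes `B : M →+ M →+ Q` with the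
binder (byte-for-byte) `(hB : ∀ a b, B (w a) b = B a (-b - w b))` («`𝒪`-balanced»), `halt : ∀ a b, B b a = -(B a b)`
and non-degeneracy, on `M = Ш(X_K/K)[2^∞]` with the CM operator `w` of (WRAP-𝒪) (`…ShaOmegaAction.lean`
`exists_cm_action_sha_two_primary`, p603310: `w` = restriction of `Ш([ζ])`, `w (w x) + w x + x = 0`; `…ShaConjugation.lean`
`exists_lemmaD_data`, p604055: the same `w` exported at the `H¹` level).  `PublishedFactsTwoPlus` has no Cassels–Tate
conjunct and no tree theorem produced `hB` for the genuine `Ш`.  This file derives `(B₂, halt, hB, non-degeneracy)` on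
`Ш(E/K)[2^∞]` from `casselsTate_pairing_functorial K` for EVERY elliptic `E/K`, EVERY endo-isogeny `φ` and EVERY `w`
under `Ш(φ)` with `w² + w + 1 = 0` — exactly the binders `(φ) (w) (hw) (hwrel)` those theorems export (both shapes of
`hw` served).  Consumer shape (W-c): the rows' engine `Theorems/SylvesterTwoHeegnerIndexCoupledTelescopeStep.lean` pairs
on a Selmer-type subgroup (`P' : Sel' →+ Sel' →+ R`); at instantiation `P'` is THIS `B₂` (or its refinement) composed
with the Kummer map `W.torsionH1ToH1 (2^M)` on `W.selmerGroup (2^M)` (image `Ш ⊓ H¹[2^M]`: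
`WeierstrassCurve.map_torsionH1ToH1_selmerGroup`) — the rows' composition, NOT built here.

## THE PRINT and THE ARGUMENT

Milne, *ADT* (2nd ed.) I Rem. 6.10(a), p. 79: «If … `f : A → B` is an isogeny, then `⟨f(a), b⟩ = ⟨a, fᵗ(b)⟩` … This
follows from the fact that the local pairings are functorial» [corpus: paper:url-620c8c980f6e p87 L36–41]; Thm.
6.13(a) (kernels); `fᵗ = f̂` for elliptic curves (Silverman *AEC* III.6.1).  ARGUMENT (no point-level datum about
`φ` — p603310/p604055 do not export `deg [ζ] = 1`): with `ψ = φ̂`, `d = deg φ`, adjointness gives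
`B(Ш(φ)a, b) = B(a, Ш(ψ)b)`; on `Ш[2^∞]`, `b = Ш(φ)(w²b)` (`w³ = 1`), so `Ш(ψ)b = d • w²b` and
`B₂(w a, b) = d • B₂(a, w²b)`.  Thrice: `B₂(a,b) = d³ • B₂(a,b)`; values are `2`-power torsion and `d² + d + 1` is
odd, so `2ʲ ∣ d³ − 1 ⇒ 2ʲ ∣ d − 1`: `d` acts as `1` and the law is EXACT (at odd `p` only `d³ ≡ 1` holds:
`7 ∣ 2³ − 1`).  NON-DEGENERACY: `Ш` is torsion; `a ∈ Ш[2^∞]` orthogonal to `Ш[2^∞]` is orthogonal to all `y` (an odd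
multiple of `y` is `2`-primary; `m·B(a,y) = 0 = 2ᵏ·B(a,y)`), hence divisible; if `Ш[2^∞]` is FINITE (`N = #Ш[2^∞]`),
`a = N•z` with an odd multiple of `z` in `Ш[2^∞]`, so `a` is odd- and `2`-power-torsion: `a = 0`.  No finiteness of
the whole `Ш` (W-b: in the TAIL `4 < #Ш(B)[2^∞]·#Ш(A)[2^∞]` + LEMMA K0's order form supply it over `K`).

## WHAT IS FORMALISED (`Ш[2^∞] = AddCommGroup.primaryComponent V.sha 2`, `ℚ/ℤ = AddCircle (1 : ℚ)`)

* §1 (private helpers, [folklore]) `nsmul_eq_self_of_pow_three_nsmul_eq_self` (the `2`-adic unit step),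
  `antisymm_of_alternating`, `eq_zero_of_forall_apply_primaryComponent_eq_zero` (kernel on a finite `2`-primary
  component of a torsion group from «kernel ⊆ divisible»), …
* §2 `CasselsTateOmega.shaMap_dual_apply_eq_degree_nsmul` (`Ш(φ̂) b = deg φ • w² b`), ★ `apply_w_eq_apply_w_w`
  (for every family `B` with the fact's adjointness clause: `B (w a) b = B a (w (w b))`); private:
  `coe_w_eq_shaMap_of_galH1` (H¹-level ⇒ Ш-level binder), `w_w_eq`, `w_w_w_eq`.
* §3 ★ `exists_casselsTate_twoPrimary_omegaBalanced (hCT) (V) [V.IsElliptic] (φ : Isogeny V V) (w) (hw) (hwrel)` :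
  `∃ B B₂`, `B` = the fact's clause (i), `B₂ a b = B a b`, `B₂ a a = 0`, `B₂ b a = -(B₂ a b)`,
  `B₂ (w a) b = B₂ a (w (w b))`, `B₂ (w a) b = B₂ a (-b - w b)`, `Finite Ш[2^∞] →` both kernels of `B₂` trivial;
  ★ `…_of_galH1` — the same from p604055's `H¹`-level `hw`.

NOT HERE: the refinement `(( , ))` / Lagrangians (rows, in tree as algebra over `hB`); the Selmer composition (rows);
the SECOND Cassels–Tate input of the Lagrangian step — the projection formula `B_K(res a, c) = B_ℚ(a, cor c)` along
`K/ℚ` — not a clause of the fact as typed, report-only (planner D560 W-d, SPEC-K-TY § (CT)); anything `j = 0`-specific.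

## References

* J. S. Milne, *Arithmetic Duality Theorems*, 2nd ed. (2006), I Prop. 6.9, Rem. 6.10(a) p. 79, Thm. 6.13(a). [MilneADT2006]
* W. G. McCallum, *Kolyvagin's work on Shafarevich–Tate groups*, LMS LN 153 (1991) 295–316, §5. [McCallumLMS1991]
* J. H. Silverman, *The Arithmetic of Elliptic Curves*, 2nd ed. (2009), III.6.1, X.4.14. [SilvermanAEC2009]
* Cell: memo two v2.21 §59.1 (i), §64.0–64.1; planner D560/D561; Mathlib `AddCommGroup.primaryComponent`,
  `addOrderOf_dvd_natCard`, `Nat.exists_eq_two_pow_mul_odd`, `Nat.coprime_two_left`, `AddMonoidHom.compl₂`.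
-/

set_option autoImplicit false

noncomputable section

open scoped Classical

universe u

namespace Literature.NumberTheory.EllipticCurves

open _root_.WeierstrassCurve

namespace CasselsTateOmega

/-! ## §1 Abelian-group algebra: the `2`-adic unit step and kernels on a `2`-primary component -/

section Algebra

variable {Q : Type*} [AddCommGroup Q]

/-- `d² + d + 1` is odd. [folklore] -/
private theorem odd_sq_add_self_add_one (d : ℕ) : Odd (d ^ 2 + d + 1) := by
  have h : Even (d * (d + 1)) := Nat.even_mul_succ_self d
  rw [show d ^ 2 + d + 1 = d * (d + 1) + 1 by ring]
  exact h.add_one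

/-- An element killed by two coprime natural numbers is zero. [folklore] -/
private theorem eq_zero_of_nsmul_eq_zero_of_coprime {v : Q} {m n : ℕ} (hmn : Nat.Coprime m n)
    (hm : m • v = 0) (hn : n • v = 0) : v = 0 := by
  have h1 : addOrderOf v = 1 :=
    Nat.eq_one_of_dvd_coprimes hmn (addOrderOf_dvd_of_nsmul_eq_zero hm)
      (addOrderOf_dvd_of_nsmul_eq_zero hn)
  exact AddMonoid.addOrderOf_eq_one_iff.mp h1

/-- **The `2`-adic unit step.** If `v` is `2`-power torsion and `d³ • v = v`, then `d • v = v`: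
the additive order `2ʲ` of `v` divides `d³ − 1 = (d − 1)(d² + d + 1)` with `d² + d + 1` odd,
so `2ʲ ∣ d − 1`. (For an odd prime `p` in place of `2` this fails: `7 ∣ 2³ − 1`.) [folklore] -/
private theorem nsmul_eq_self_of_pow_three_nsmul_eq_self {v : Q} {k d : ℕ} (hk : 2 ^ k • v = 0)
    (hd : d ^ 3 • v = v) : d • v = v := by
  rcases Nat.eq_zero_or_pos d with rfl | hd0
  · simpa using hd
  -- `addOrderOf v = 2 ^ j`
  obtain ⟨j, -, hj⟩ := (Nat.dvd_prime_pow Nat.prime_two).mp (addOrderOf_dvd_of_nsmul_eq_zero hk)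
  -- `(d ^ 3 - 1) • v = 0`
  obtain ⟨e, rfl⟩ : ∃ e, d = e + 1 := ⟨d - 1, (Nat.sub_add_cancel hd0).symm⟩
  have hfac : (e + 1) ^ 3 = e * ((e + 1) ^ 2 + (e + 1) + 1) + 1 := by ring
  have h0 : (e * ((e + 1) ^ 2 + (e + 1) + 1)) • v = 0 := by
    have h1 : (e * ((e + 1) ^ 2 + (e + 1) + 1)) • v + v = v := by
      conv_rhs => rw [← hd]
      rw [hfac, add_nsmul, one_nsmul]
    simpa using h1
  have hdvd : 2 ^ j ∣ e * ((e + 1) ^ 2 + (e + 1) + 1) := hj ▸ addOrderOf_dvd_of_nsmul_eq_zero h0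
  have hcop : Nat.Coprime (2 ^ j) ((e + 1) ^ 2 + (e + 1) + 1) :=
    Nat.Coprime.pow_left j (odd_sq_add_self_add_one (e + 1)).coprime_two_left
  have he : 2 ^ j ∣ e := hcop.dvd_of_dvd_mul_right hdvd
  have hev : e • v = 0 := by
    rw [← addOrderOf_dvd_iff_nsmul_eq_zero, hj]
    exact he
  rw [add_nsmul, one_nsmul, hev, zero_add]

/-- A biadditive alternating pairing is antisymmetric. [folklore] -/
private theorem antisymm_of_alternating {M : Type*} [AddCommGroup M] (B : M →+ M →+ Q)
    (halt : ∀ x, B x x = 0) (a b : M) : B b a = -(B a b) := by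
  have h := halt (a + b)
  rw [map_add, map_add B a b, AddMonoidHom.add_apply, AddMonoidHom.add_apply, halt a, halt b,
    zero_add, add_zero] at h
  exact eq_neg_of_add_eq_zero_left h

variable {G : Type*} [AddCommGroup G]

/-- In a torsion abelian group, an odd multiple of any element lies in the `2`-primary
component: if `y` has order `2ᵉ·m` with `m` odd then `2ᵉ • (m • y) = 0`. [folklore] -/
private theorem exists_odd_nsmul_mem_primaryComponent_two (htors : AddMonoid.IsTorsion G) (y : G) :
    ∃ m : ℕ, Odd m ∧ m • y ∈ AddCommGroup.primaryComponent G 2 := by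
  have hn0 : addOrderOf y ≠ 0 := (htors y).addOrderOf_pos.ne'
  obtain ⟨e, m, hm, hn⟩ := Nat.exists_eq_two_pow_mul_odd hn0
  refine ⟨m, hm, (AddCommGroup.mem_primaryComponent (G := G)).mpr ⟨e, ?_⟩⟩
  rw [← mul_nsmul', ← hn]
  exact addOrderOf_nsmul_eq_zero y

/-- **Left kernel on the `2`-primary component.** `G` a torsion abelian group, `B` a biadditive
pairing whose left kernel consists of divisible elements, `G[2^∞]` finite: an element of `G[2^∞]`
pairing trivially with `G[2^∞]` pairs trivially with every `y` (an odd multiple of `y` is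
`2`-primary), so it is divisible, `= N • z` with `N = #G[2^∞]`; an odd multiple of `z` is `2`-primary
and killed by `N`, so the element is odd-torsion and `2`-power-torsion, hence `0`. [folklore] -/
private theorem eq_zero_of_forall_apply_primaryComponent_eq_zero (htors : AddMonoid.IsTorsion G)
    (B : G →+ G →+ Q) (hker : ∀ x, (∀ y, B x y = 0) → x ∈ AddSubgroup.divisibleElements G)
    [Finite (AddCommGroup.primaryComponent G 2)] {a : G}
    (ha : a ∈ AddCommGroup.primaryComponent G 2)
    (horth : ∀ y ∈ AddCommGroup.primaryComponent G 2, B a y = 0) : a = 0 := by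
  obtain ⟨k, hk⟩ := (AddCommGroup.mem_primaryComponent (G := G)).mp ha
  -- (i) `a` is in the left kernel of `B` on all of `G`
  have hleft : ∀ y, B a y = 0 := by
    intro y
    obtain ⟨m, hm, hmy⟩ := exists_odd_nsmul_mem_primaryComponent_two htors y
    have h1 : m • B a y = 0 := by rw [← map_nsmul]; exact horth _ hmy
    have h2 : 2 ^ k • B a y = 0 := by
      rw [← AddMonoidHom.nsmul_apply, ← map_nsmul, hk, map_zero, AddMonoidHom.zero_apply]
    exact eq_zero_of_nsmul_eq_zero_of_coprime (hm.coprime_two_left.pow_left k) h2 h1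
  -- (ii) `a` is divisible; write `a = N • z` with `N = #G[2^∞]`
  have hdiv := hker a hleft
  have hNpos : 0 < Nat.card (AddCommGroup.primaryComponent G 2) := Nat.card_pos
  obtain ⟨z, hz⟩ := (AddSubgroup.mem_divisibleElements_iff _ a).mp hdiv _ hNpos
  obtain ⟨m, hm, hmz⟩ := exists_odd_nsmul_mem_primaryComponent_two htors z
  -- `N = #G[2^∞]` kills the `2`-primary component
  have hNz : Nat.card (AddCommGroup.primaryComponent G 2) • (m • z) = 0 := by
    have h := addOrderOf_dvd_natCard (⟨m • z, hmz⟩ : AddCommGroup.primaryComponent G 2)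
    rw [addOrderOf_dvd_iff_nsmul_eq_zero] at h
    have h' := congrArg Subtype.val h
    rw [AddSubmonoidClass.coe_nsmul, ZeroMemClass.coe_zero] at h'
    exact h'
  have hma : m • a = 0 := by
    rw [← hz, ← mul_nsmul', mul_comm, mul_nsmul', hNz]
  exact eq_zero_of_nsmul_eq_zero_of_coprime (hm.coprime_two_left.pow_left k) hk hma

end Algebra

/-! ## §2 The Cassels–Tate pairing against a `ℤ[ζ₃]`-action on `Ш(E/K)[2^∞]` induced by an
endo-isogeny -/

section Sha

variable {K : Type u} [Field K] [NumberField K] {V : WeierstrassCurve K}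

/-- `w² + w + 1 = 0` gives `w (w x) = −x − w x`. [folklore] -/
private theorem w_w_eq {M : Type*} [AddCommGroup M] (w : M →+ M) (hwrel : ∀ x, w (w x) + w x + x = 0)
    (x : M) : w (w x) = -x - w x := by
  have h := hwrel x
  rw [add_assoc] at h
  rw [eq_neg_of_add_eq_zero_left h]
  abel

/-- `w² + w + 1 = 0` implies `w³ = 1`. [folklore] -/
private theorem w_w_w_eq {M : Type*} [AddCommGroup M] (w : M →+ M) (hwrel : ∀ x, w (w x) + w x + x = 0)
    (x : M) : w (w (w x)) = x := by
  rw [w_w_eq w hwrel x, map_sub, map_neg, w_w_eq w hwrel x]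
  abel

/-- From the `H¹`-level compatibility (the binder shape of the cell's `exists_lemmaD_data`:
`w x` and `H¹(φ) x` agree in `H¹(K, E)`) to the `Ш`-level one (`w x = Ш(φ) x` in `Ш(E/K)`).
[folklore] -/
private theorem coe_w_eq_shaMap_of_galH1 (φ : Isogeny V V)
    (w : AddCommGroup.primaryComponent V.sha 2 →+ AddCommGroup.primaryComponent V.sha 2)
    (hw : ∀ x, (((w x : AddCommGroup.primaryComponent V.sha 2) : V.sha) : V.galH1) =
      galH1Map φ.toAddMonoidHom φ.equivariant ((x : V.sha) : V.galH1))
    (x : AddCommGroup.primaryComponent V.sha 2) :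
    ((w x : AddCommGroup.primaryComponent V.sha 2) : V.sha) =
      shaMap φ.toAddMonoidHom φ.equivariant φ.hasLocalPointsMaps_toAddMonoidHom x := by
  apply Subtype.ext
  rw [hw, coe_shaMap_apply]

/-- **The dual isogeny on `Ш[2^∞]` is `deg φ · w²`.** For an endo-isogeny `φ` of `E/K`, an
isogeny `ψ` with `ψ ∘ φ = [deg φ]` (the dual), and an operator `w` on `Ш(E/K)[2^∞]` lying under
`Ш(φ)` with `w² + w + 1 = 0`: `Ш(ψ) b = deg φ • w (w b)` for `b ∈ Ш(E/K)[2^∞]` (since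
`b = Ш(φ) (w² b)` and `Ш(ψ) Ш(φ) = deg φ`, Milne *ADT* I, proof of Lemma 7.1(b): «there exists an isogeny
`g : B → A` such that `g ∘ f = deg f`»). [cite: MilneADT2006, Ch. I Lemma 7.1(b) (proof), p. 96] -/
theorem shaMap_dual_apply_eq_degree_nsmul (φ ψ : Isogeny V V)
    (hψ : ∀ P, ψ (φ P) = (φ.degree : ℤ) • P)
    (w : AddCommGroup.primaryComponent V.sha 2 →+ AddCommGroup.primaryComponent V.sha 2)
    (hw : ∀ x, ((w x : AddCommGroup.primaryComponent V.sha 2) : V.sha) =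
      shaMap φ.toAddMonoidHom φ.equivariant φ.hasLocalPointsMaps_toAddMonoidHom x)
    (hwrel : ∀ x, w (w x) + w x + x = 0) (b : AddCommGroup.primaryComponent V.sha 2) :
    shaMap ψ.toAddMonoidHom ψ.equivariant ψ.hasLocalPointsMaps_toAddMonoidHom b =
      φ.degree • ((w (w b) : AddCommGroup.primaryComponent V.sha 2) : V.sha) := by
  conv_lhs => rw [← w_w_w_eq w hwrel b, hw]
  exact Isogeny.shaMap_shaMap_eq_nsmul φ ψ hψ _

variable [V.IsElliptic]

/-- **The Cassels–Tate pairing is `𝒪`-balanced (exactly) on `Ш(E/K)[2^∞]`.** For every family of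
pairings `B_W` on the `Ш(W/K)` that is ADJOINT along dual pairs (clause (ii) of
`casselsTate_pairing_functorial K`, Milne *ADT* I Rem. 6.10(a)), every endo-isogeny `φ` of `E = V` and
every `w` on `Ш(E/K)[2^∞]` under `Ш(φ)` with `w² + w + 1 = 0`: `B (w a) b = B a (w (w b))`. Step 1
(`S`): `B(w a, b) = d • B(a, w² b)`, `d = deg φ`, by adjointness with the dual `ψ` and
`shaMap_dual_apply_eq_degree_nsmul`. Step 2: iterating thrice (`w³ = 1`) `B(a, b) = d³ • B(a, b)`;
every value is `2`-power torsion and `d² + d + 1` is odd, so `d` acts as `1`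
(`nsmul_eq_self_of_pow_three_nsmul_eq_self`). No hypothesis on `φ` beyond being an isogeny (in the
application `φ = [ζ₃]`, `d = 1`, but the cell's packages do not export that).
[cite: MilneADT2006, I Rem. 6.10(a)] -/
theorem apply_w_eq_apply_w_w
    {B : (W : WeierstrassCurve K) → (W.sha →+ W.sha →+ AddCircle (1 : ℚ))}
    (hadj : ∀ (W W' : WeierstrassCurve K) [W.IsElliptic] [W'.IsElliptic] (φ : Isogeny W W')
      (ψ : Isogeny W' W), (∀ P, ψ (φ P) = (φ.degree : ℤ) • P) →
      ∀ (x : W.sha) (y : W'.sha),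
        B W' (shaMap φ.toAddMonoidHom φ.map_smul φ.hasLocalPointsMaps_toAddMonoidHom x) y =
          B W x (shaMap ψ.toAddMonoidHom ψ.map_smul ψ.hasLocalPointsMaps_toAddMonoidHom y))
    (φ : Isogeny V V)
    (w : AddCommGroup.primaryComponent V.sha 2 →+ AddCommGroup.primaryComponent V.sha 2)
    (hw : ∀ x, ((w x : AddCommGroup.primaryComponent V.sha 2) : V.sha) =
      shaMap φ.toAddMonoidHom φ.equivariant φ.hasLocalPointsMaps_toAddMonoidHom x)
    (hwrel : ∀ x, w (w x) + w x + x = 0) (a b : AddCommGroup.primaryComponent V.sha 2) :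
    B V (w a) b = B V a (w (w b)) := by
  obtain ⟨ψ, hψ⟩ := φ.exists_dual_of_isElliptic
  -- Step 1: the law with the degree
  have S : ∀ x y : AddCommGroup.primaryComponent V.sha 2,
      B V (w x) y = φ.degree • B V x (w (w y)) := fun x y ↦ by
    rw [hw, hadj V V φ ψ hψ (x : V.sha) (y : V.sha),
      shaMap_dual_apply_eq_degree_nsmul φ ψ hψ w hw hwrel y, map_nsmul]
  have h3 := w_w_w_eq w hwrel
  -- Step 2: `d³` acts trivially on every value, hence so does `d`
  have hunit : ∀ x y : AddCommGroup.primaryComponent V.sha 2,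
      φ.degree • B V (x : V.sha) (y : V.sha) = B V (x : V.sha) (y : V.sha) := by
    intro x y
    obtain ⟨k, hk⟩ := (AddCommGroup.mem_primaryComponent (G := V.sha)).mp x.2
    have htor : 2 ^ k • B V (x : V.sha) (y : V.sha) = 0 := by
      rw [← AddMonoidHom.nsmul_apply, ← map_nsmul, hk, map_zero, AddMonoidHom.zero_apply]
    have e1 := S (w (w x)) y
    have e2 := S (w x) (w (w y))
    have e3 := S x (w y)
    rw [h3] at e1 e2 e3
    rw [e2, e3, smul_smul, smul_smul] at e1
    refine nsmul_eq_self_of_pow_three_nsmul_eq_self htor ?_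
    rw [show φ.degree ^ 3 = φ.degree * φ.degree * φ.degree by ring]
    exact e1.symm
  rw [S, hunit]

end Sha

end CasselsTateOmega

/-! ## §3 The packaged statement consumed by the LEMMA-D pairing algebra -/

section Main

variable {K : Type u} [Field K] [NumberField K]

open CasselsTateOmega

/-- **(WRAP-CT) The Cassels–Tate pairing on `Ш(E/K)[2^∞]`, alternating, non-degenerate and
`𝒪`-BALANCED for a `ℤ[ζ₃]`-action induced by an endo-isogeny.** Let `K` be a number field for
which the Cassels–Tate pairing family exists in functorial form
(`casselsTate_pairing_functorial K`: Milne, *ADT*, I Prop. 6.9, Rem. 6.10(a), Thm. 6.13(a) — a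
NAMED FACT of the tree, displayed as the hypothesis `hCT`), `E = V` an elliptic curve over `K`,
`φ : E → E` an endo-isogeny and `w` an additive operator on the `2`-primary part `Ш(E/K)[2^∞]` of
the tree's `Ш(E/K)` lying under `Ш(φ)` (`hw`) with `w² + w + 1 = 0` (`hwrel`) — e.g. `φ = [ζ₃]`
on `y² = x³ + b` over `K ∋ ζ₃` (the cell's (WRAP-𝒪), `SylvesterTwoShaOmegaAction`). Then THE
Cassels–Tate pairing `B` of `E` and its restriction `B₂` to `Ш(E/K)[2^∞]` satisfy: `B` is
alternating with left kernel the divisible subgroup (the fact); `B₂` is alternating and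
antisymmetric; `B₂ (w a) b = B₂ a (−b − w b)` — the `𝒪`-BALANCEDNESS `⟨ωa, b⟩ = ⟨a, ω̄b⟩`
consumed by the sesquilinear refinement (memo two §59.1 (i); McCallum 1991 §5) — obtained from
the adjointness of `Ш(φ)` and `Ш(φ̂)` and a `2`-adic unit argument (`apply_w_eq_apply_w_w`);
and if `Ш(E/K)[2^∞]` is finite, `B₂` is non-degenerate on both sides (from «kernel = divisible»,
`Ш` torsion, no finiteness of the whole `Ш` needed). Nothing about the order of `Ш` is claimed.
[cite: MilneADT2006, I Prop. 6.9, Rem. 6.10(a), Thm. 6.13(a)]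
[cite: McCallumLMS1991, §5] -/
theorem exists_casselsTate_twoPrimary_omegaBalanced (hCT : casselsTate_pairing_functorial K)
    (V : WeierstrassCurve K) [V.IsElliptic] (φ : Isogeny V V)
    (w : AddCommGroup.primaryComponent V.sha 2 →+ AddCommGroup.primaryComponent V.sha 2)
    (hw : ∀ x, ((w x : AddCommGroup.primaryComponent V.sha 2) : V.sha) =
      shaMap φ.toAddMonoidHom φ.equivariant φ.hasLocalPointsMaps_toAddMonoidHom x)
    (hwrel : ∀ x, w (w x) + w x + x = 0) :
    ∃ (B : V.sha →+ V.sha →+ AddCircle (1 : ℚ))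
      (B₂ : AddCommGroup.primaryComponent V.sha 2 →+ AddCommGroup.primaryComponent V.sha 2 →+
        AddCircle (1 : ℚ)),
      (∀ x, B x x = 0) ∧ (∀ x, (∀ y, B x y = 0) ↔ x ∈ AddSubgroup.divisibleElements V.sha) ∧
      (∀ a b, B₂ a b = B a b) ∧
      (∀ a, B₂ a a = 0) ∧ (∀ a b, B₂ b a = -(B₂ a b)) ∧
      (∀ a b, B₂ (w a) b = B₂ a (w (w b))) ∧
      (∀ a b, B₂ (w a) b = B₂ a (-b - w b)) ∧
      (Finite (AddCommGroup.primaryComponent V.sha 2) →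
        (∀ a, (∀ b, B₂ a b = 0) → a = 0) ∧ (∀ b, (∀ a, B₂ a b = 0) → b = 0)) := by
  obtain ⟨Bf, hBi, hBii⟩ := hCT
  obtain ⟨halt, hker⟩ := hBi V
  let H := AddCommGroup.primaryComponent V.sha 2
  let B₂ : H →+ H →+ AddCircle (1 : ℚ) := ((Bf V).comp H.subtype).compl₂ H.subtype
  have hB₂ : ∀ a b : H, B₂ a b = Bf V (a : V.sha) (b : V.sha) := fun a b ↦ rfl
  have hbal : ∀ a b : H, B₂ (w a) b = B₂ a (w (w b)) := fun a b ↦ by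
    rw [hB₂, hB₂]
    exact apply_w_eq_apply_w_w hBii φ w hw hwrel a b
  have halt₂ : ∀ a : H, B₂ a a = 0 := fun a ↦ by rw [hB₂]; exact halt _
  have hanti₂ : ∀ a b : H, B₂ b a = -(B₂ a b) := antisymm_of_alternating B₂ halt₂
  refine ⟨Bf V, B₂, halt, hker, hB₂, halt₂, hanti₂, hbal, fun a b ↦ ?_, fun hfin ↦ ⟨?_, ?_⟩⟩
  · rw [hbal, w_w_eq w hwrel b]
  · intro a ha
    have h0 : (a : V.sha) = 0 :=
      eq_zero_of_forall_apply_primaryComponent_eq_zero (WeierstrassCurve.isTorsion_sha V) (Bf V)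
        (fun x hx ↦ (hker x).mp hx) a.2 fun y hy ↦ by
          have := ha ⟨y, hy⟩
          rwa [hB₂] at this
    exact Subtype.ext h0
  · intro b hb
    have hb' : ∀ a : H, B₂ b a = 0 := fun a ↦ by rw [hanti₂, hb a, neg_zero]
    have h0 : (b : V.sha) = 0 :=
      eq_zero_of_forall_apply_primaryComponent_eq_zero (WeierstrassCurve.isTorsion_sha V) (Bf V)
        (fun x hx ↦ (hker x).mp hx) b.2 fun y hy ↦ by
          have := hb' ⟨y, hy⟩
          rwa [hB₂] at this
    exact Subtype.ext h0

/-- **Same, with the `H¹`-level compatibility binder** of the cell's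
`SylvesterTwoShaConjugation.exists_lemmaD_data` (p604055): `w x` and `H¹(φ) x` agree in
`H¹(K, E)`. [cite: MilneADT2006, I Prop. 6.9, Rem. 6.10(a), Thm. 6.13(a)] -/
theorem exists_casselsTate_twoPrimary_omegaBalanced_of_galH1
    (hCT : casselsTate_pairing_functorial K)
    (V : WeierstrassCurve K) [V.IsElliptic] (φ : Isogeny V V)
    (w : AddCommGroup.primaryComponent V.sha 2 →+ AddCommGroup.primaryComponent V.sha 2)
    (hw : ∀ x, (((w x : AddCommGroup.primaryComponent V.sha 2) : V.sha) : V.galH1) =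
      galH1Map φ.toAddMonoidHom φ.equivariant ((x : V.sha) : V.galH1))
    (hwrel : ∀ x, w (w x) + w x + x = 0) :
    ∃ (B : V.sha →+ V.sha →+ AddCircle (1 : ℚ))
      (B₂ : AddCommGroup.primaryComponent V.sha 2 →+ AddCommGroup.primaryComponent V.sha 2 →+
        AddCircle (1 : ℚ)),
      (∀ x, B x x = 0) ∧ (∀ x, (∀ y, B x y = 0) ↔ x ∈ AddSubgroup.divisibleElements V.sha) ∧
      (∀ a b, B₂ a b = B a b) ∧
      (∀ a, B₂ a a = 0) ∧ (∀ a b, B₂ b a = -(B₂ a b)) ∧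
      (∀ a b, B₂ (w a) b = B₂ a (w (w b))) ∧
      (∀ a b, B₂ (w a) b = B₂ a (-b - w b)) ∧
      (Finite (AddCommGroup.primaryComponent V.sha 2) →
        (∀ a, (∀ b, B₂ a b = 0) → a = 0) ∧ (∀ b, (∀ a, B₂ a b = 0) → b = 0)) :=
  exists_casselsTate_twoPrimary_omegaBalanced hCT V φ w (coe_w_eq_shaMap_of_galH1 φ w hw) hwrel

end Main

end Literature.NumberTheory.EllipticCurves

end
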